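import Mathlib
import HarnessLib
import Summits.Langlands.Langlands.Theses.CMFreeCompletedClosure
import Literature.NumberTheory.GaloisRepresentations.ResidualGaloisRep

/-!
# Birth skeleton for the crux `ProAutomorphy` (route `CMFreeCompletedClosure`, item `stmt-Langlands-18474`)

Line `birth` (skeleton-register, 2026-08-17).  The crux, verbatim from the route file:
every irreducible geometric `ρ : Γ_E → GL_n(ℚ̄_ℓ)` over a totally complex number field `E` is
**pro-automorphic** — its Frobenius eigensystem is a `ℤ̄_ℓ`-valued system of Hecke eigenvalues
`a` occurring (`TameLevel.EigensystemOccurs`) in the completed cohomology of `GL_n/E` at some tame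
level `𝒰`, in some degree `i`, with `IsAssociatedFamily n 𝒰.bad a ρ`.

## The line: residual occurrence, then pro-automorphy lifting in the big Hecke algebra

This is the route's own two-layer plan ("ProAutomorphy ⇐ residual automorphy mod 𝔪 → big
`R = 𝕋_𝔪`") in the shape of Pan's proof of Fontaine–Mazur in the residually reducible case
[cite: Pan2022, Thm. 1.0.2 and §1 (strategy: big `R = 𝕋`, then classicality)] and of
Gee–Newton's big `R = 𝕋^S(U^p)_𝔪` theorem [cite: GeeNewton2020, §1 Thm. 2, §3.3 Conj. 3.3.2]:

* `stub_residualOccurrence` (STUB S1, Serre-type residual pro-automorphy + integral lift of the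
  occurring eigensystem): under the crux's hypotheses there is an occurring `ℤ̄_ℓ`-valued
  eigensystem `a` at some tame level `𝒰 ⊇` (ramification of `ρ`) whose Hecke–Frobenius
  polynomials agree with the (integral) Frobenius characteristic polynomials of `ρ`
  **modulo `𝔪_{ℤ̄_ℓ}`** — i.e. `ρ̄` is automorphic in the torsion/completed cohomology of `GL_n/E`
  (Brauer–Nesbitt form: congruence of characteristic polynomials, the vocabulary of
  `IsAssociatedFamily`; integrality of `det(X − ρ(Frob_v))` is the tree's
  `FramedGaloisRep.HasFrobCharpolyAt.exists_eq_map_of_numberField`).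
* `stub_liftingAbsIrr` (STUB S2, pro-automorphy lifting, `ρ̄` absolutely irreducible): given such a
  residually associated occurring eigensystem and `ρ.IsResiduallyAbsIrreducible`, the eigensystem of
  `ρ` itself occurs at some tame level — the "big `R_ρ̄ = 𝕋(U^p)_𝔪`" statement of
  Gee–Newton/Emerton read at the `ℤ̄_ℓ`-point `ρ` of `R_ρ̄`.
* `stub_liftingResRed` (STUB S3, the same with `ρ̄` NOT absolutely irreducible): the
  Skinner–Wiles / Thorne / Allen–Newton–Thorne / Pan regime, isolated because the crux's
  "why it might fail" names it (no big-image mechanism; Eisenstein maximal ideals).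

Composition `ProAutomorphy_of : S1 → S2 → S3 → ProAutomorphy` (kernel-checked, no `sorry` outside
the three `stub_*`): introduce the crux's binders, take `(𝒰, i, a)` from S1, split on
`ρ.IsResiduallyAbsIrreducible` (classical `by_cases`), apply S2 resp. S3; the conclusions are the
crux's conclusion literally (`padicAlgClIntegers ℓ` is the `abbrev` for
`(Valued.v : Valuation (PadicAlgCl ℓ) ℝ≥0).valuationSubring`).

Foreseen second layer (NOT stubs here, two layers max): S1 = (Serre-type conjecture mod `𝔪` for
`GL_n` over totally complex `E`: `ρ̄` ↔ a mod-`ℓ` eigenclass) + (every non-Eisenstein maximal ideal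
`𝔪` of the big Hecke algebra has a `ℤ̄_ℓ`-point occurring at every torsion depth); S2 ⊇ the
small-image (non-adequate `ρ̄|_{E(ζ_ℓ)}`) subcase.

Disproof used: none exists (`ledger crux ls stmt-Langlands-18474`: no workfiles, no `Disproof.lean`,
no `Negative/` lemma, 2026-08-17); `ledger negatives --problem Langlands` checked — no refuted
statement of the stubs' shape.  No `_false_without_` theorem to honour.
-/

set_option linter.dupNamespace false
set_option linter.unusedVariables false

noncomputable section

namespace Summit.Langlands.Langlands.Cruxes.ProAutomorphy.Birth

open scoped NNReal
open Literature.NumberTheory.Automorphic Literature.NumberTheory.GaloisRepresentations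
open Literature.NumberTheory.Automorphic.BigHeckeGLn
open IsDedekindDomain NumberField

/-! ## 1. The three stubs -/

/-- **STUB S1 — residual occurrence (Serre-type residual pro-automorphy over a totally complex
field, with an integral occurring lift of the eigensystem).**  For `E` totally complex, `n ≥ 1`,
`ρ : Γ_E → GL_n(ℚ̄_ℓ)` irreducible and geometric (w.r.t. the reciprocity data `R`), there are a tame
level `𝒰` for `GL_n/E` at `ℓ`, a degree `i` and a `ℤ̄_ℓ`-valued eigensystem `a` occurring in the
completed cohomology tower of `𝒰` in degree `i` such that, for every finite place `v ∉ 𝒰.bad`,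
`ρ` is unramified at `v` and `det(X − ρ(Frob_v))` is an integral polynomial `P ∈ ℤ̄_ℓ[X]` congruent
modulo `𝔪_{ℤ̄_ℓ}` to the Hecke–Frobenius polynomial of `a` at `v`.  Known: `n = 2`, `E` imaginary
quadratic, many `ρ̄` (Figueiredo, Şengün, Torrey: computational / theoretical evidence for Serre's
conjecture over imaginary quadratic fields); open in general (no Khare–Wintenberger over fields that
are not totally real).  Why it might fail as typed: the integral LIFT clause — a non-Eisenstein `𝔪`
of the big Hecke algebra all of whose torsion-depth eigenclasses refuse a single `ℤ̄_ℓ`-valued `a`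
(`𝕋_𝔪` entirely `ℓ`-power torsion in the relevant degree).
[cite: Figueiredo1999, §1 (Serre's conjecture over imaginary quadratic fields)]
[cite: Serre1987, (3.2.3)–(3.2.4)] [cite: CalegariEmerton2011, §8] -/
theorem stub_residualOccurrence :
    ∀ (E : Type) [Field E] [NumberField E], NumberField.IsTotallyComplex E → ∀ (n : ℕ), 0 < n →
    ∀ (R : Summit.Langlands.ReciprocityData E) (ℓ : ℕ) [Fact ℓ.Prime]
      (ρ : FramedGaloisRep E (PadicAlgCl ℓ) n),
      ρ.toGaloisRep.IsIrreducible → Summit.Langlands.IsGeometricFramed R ρ →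
      ∃ (𝒰 : TameLevel n E ℓ) (i : ℕ)
        (a : HeightOneSpectrum (𝓞 E) → ℕ → padicAlgClIntegers ℓ),
        𝒰.EigensystemOccurs (padicAlgClIntegers ℓ) a i ∧
        ∀ v ∉ 𝒰.bad, ρ.IsUnramifiedAt v ∧
          ∃ P : Polynomial (padicAlgClIntegers ℓ),
            ρ.HasFrobCharpolyAt v (P.map (padicAlgClIntegers ℓ).subtype) ∧
            P.map (IsLocalRing.residue (padicAlgClIntegers ℓ)) =
              (heckeFrobPoly n (Ideal.absNorm v.asIdeal) (a v)).map
                (IsLocalRing.residue (padicAlgClIntegers ℓ)) := by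
  sorry

/-- **STUB S2 — pro-automorphy lifting, residually absolutely irreducible case (big `R = 𝕋_𝔪`).**
If `ρ` (as in the crux) is residually absolutely irreducible and some occurring `ℤ̄_ℓ`-valued
eigensystem `a` at a tame level `𝒰` is associated with `ρ` modulo `𝔪_{ℤ̄_ℓ}` outside `𝒰.bad`
(the output of STUB S1), then the eigensystem of `ρ` itself occurs: there are `𝒰', i', a'` with
`a'` occurring and `IsAssociatedFamily n 𝒰'.bad a' ρ` (exact equality of Frobenius polynomials;
the level may be changed to absorb the ramification and the weight).  This is "`R_ρ̄ ↠ 𝕋(U^p)_𝔪` is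
an isomorphism" evaluated at the `ℤ̄_ℓ`-point `ρ`: Gee–Newton prove `R ≅ 𝕋^S(U^p)_𝔪` (Thm. 2) under
the Calegari–Geraghty vanishing (a) and codimension (b) hypotheses — known for `n = 2`, `E`
imaginary quadratic — plus a further codimension hypothesis `j ≥ dim B` on the fibre at `𝔪` (open),
for `ρ̄|_{E(ζ_ℓ)}` adequate; conditional in general on these and on local–global compatibility for
torsion classes.  Why it might fail: small residual image (`ρ̄|_{E(ζ_ℓ)}` not adequate — still
inside this stub), `ρ` on no component of `Spec R_ρ̄` met by `Spec 𝕋_𝔪` when `R_ρ̄ → 𝕋_𝔪` has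
non-nilpotent kernel (failure of the expected codimension of patched completed homology).
[cite: GeeNewton2020, §1 Thm. 2 and §3.3 Conj. 3.3.2] [cite: CalegariGeraghty2017, §1]
[cite: Scholze2015, Thm. V.4.1] -/
theorem stub_liftingAbsIrr :
    ∀ (E : Type) [Field E] [NumberField E], NumberField.IsTotallyComplex E → ∀ (n : ℕ), 0 < n →
    ∀ (R : Summit.Langlands.ReciprocityData E) (ℓ : ℕ) [Fact ℓ.Prime]
      (ρ : FramedGaloisRep E (PadicAlgCl ℓ) n),
      ρ.toGaloisRep.IsIrreducible → Summit.Langlands.IsGeometricFramed R ρ →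
      ρ.IsResiduallyAbsIrreducible →
      ∀ (𝒰 : TameLevel n E ℓ) (i : ℕ)
        (a : HeightOneSpectrum (𝓞 E) → ℕ → padicAlgClIntegers ℓ),
        𝒰.EigensystemOccurs (padicAlgClIntegers ℓ) a i →
        (∀ v ∉ 𝒰.bad, ρ.IsUnramifiedAt v ∧
          ∃ P : Polynomial (padicAlgClIntegers ℓ),
            ρ.HasFrobCharpolyAt v (P.map (padicAlgClIntegers ℓ).subtype) ∧
            P.map (IsLocalRing.residue (padicAlgClIntegers ℓ)) =
              (heckeFrobPoly n (Ideal.absNorm v.asIdeal) (a v)).map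
                (IsLocalRing.residue (padicAlgClIntegers ℓ))) →
        ∃ (𝒰' : TameLevel n E ℓ) (i' : ℕ)
          (a' : HeightOneSpectrum (𝓞 E) → ℕ → padicAlgClIntegers ℓ),
          𝒰'.EigensystemOccurs (padicAlgClIntegers ℓ) a' i' ∧
          IsAssociatedFamily n 𝒰'.bad
            (fun v j => ((a' v j : padicAlgClIntegers ℓ) : PadicAlgCl ℓ)) ρ := by
  sorry

/-- **STUB S3 — pro-automorphy lifting, residually NOT absolutely irreducible case (the hardest
stub).**  The same lifting statement as STUB S2 for `ρ` whose reductions are all absolutely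
reducible (`ρ̄^{ss}` a sum of at least two pieces over `𝔽̄_ℓ`; Eisenstein-type maximal ideals).
Known mechanisms: Skinner–Wiles (ordinary `GL_2/ℚ` and totally real), Thorne and
Allen–Newton–Thorne (`GL_n` over CM fields, polarized, residually Schur), Pan (`GL_2/ℚ`, big
`R = 𝕋` by patching completed homology at a one-dimensional prime).  None is available for
non-polarizable `ρ` over a totally complex non-CM `E`.  Why it might fail: no Taylor–Wiles primes
controlling the reducible locus without a polarization; the Eisenstein ideal of the big Hecke
algebra may see only the boundary/Eisenstein cohomology, so `ρ` need not be a point of `𝕋_𝔪`.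
[cite: Pan2022, Thm. 1.0.2] [cite: SkinnerWiles1999, §1] [cite: Thorne2014, Thm. 1.1]
[cite: AllenNewtonThorne2020, Thm. 1.1] -/
theorem stub_liftingResRed :
    ∀ (E : Type) [Field E] [NumberField E], NumberField.IsTotallyComplex E → ∀ (n : ℕ), 0 < n →
    ∀ (R : Summit.Langlands.ReciprocityData E) (ℓ : ℕ) [Fact ℓ.Prime]
      (ρ : FramedGaloisRep E (PadicAlgCl ℓ) n),
      ρ.toGaloisRep.IsIrreducible → Summit.Langlands.IsGeometricFramed R ρ →
      ¬ ρ.IsResiduallyAbsIrreducible →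
      ∀ (𝒰 : TameLevel n E ℓ) (i : ℕ)
        (a : HeightOneSpectrum (𝓞 E) → ℕ → padicAlgClIntegers ℓ),
        𝒰.EigensystemOccurs (padicAlgClIntegers ℓ) a i →
        (∀ v ∉ 𝒰.bad, ρ.IsUnramifiedAt v ∧
          ∃ P : Polynomial (padicAlgClIntegers ℓ),
            ρ.HasFrobCharpolyAt v (P.map (padicAlgClIntegers ℓ).subtype) ∧
            P.map (IsLocalRing.residue (padicAlgClIntegers ℓ)) =
              (heckeFrobPoly n (Ideal.absNorm v.asIdeal) (a v)).map
                (IsLocalRing.residue (padicAlgClIntegers ℓ))) →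
        ∃ (𝒰' : TameLevel n E ℓ) (i' : ℕ)
          (a' : HeightOneSpectrum (𝓞 E) → ℕ → padicAlgClIntegers ℓ),
          𝒰'.EigensystemOccurs (padicAlgClIntegers ℓ) a' i' ∧
          IsAssociatedFamily n 𝒰'.bad
            (fun v j => ((a' v j : padicAlgClIntegers ℓ) : PadicAlgCl ℓ)) ρ := by
  sorry

/-! ## 2. The stub statements as named `Prop`s (literally their types) -/

namespace _Goal

/-- The statement of `stub_residualOccurrence`, as a named `Prop` (literally its type). [folklore] -/
def stub_residualOccurrence : Prop :=
  type_of% @Summit.Langlands.Langlands.Cruxes.ProAutomorphy.Birth.stub_residualOccurrence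

/-- The statement of `stub_liftingAbsIrr`, as a named `Prop` (literally its type). [folklore] -/
def stub_liftingAbsIrr : Prop :=
  type_of% @Summit.Langlands.Langlands.Cruxes.ProAutomorphy.Birth.stub_liftingAbsIrr

/-- The statement of `stub_liftingResRed`, as a named `Prop` (literally its type). [folklore] -/
def stub_liftingResRed : Prop :=
  type_of% @Summit.Langlands.Langlands.Cruxes.ProAutomorphy.Birth.stub_liftingResRed

end _Goal

/-! ## 3. The composition (kernel-checked, no `sorry`) -/

/-- **`ProAutomorphy` from the three stubs.**  The hypotheses are, verbatim, the statements of the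
three stubs; the conclusion is the route decl
`Summit.Langlands.Langlands.Theses.CMFreeCompletedClosure.ProAutomorphy`, by name: take the
residually associated occurring eigensystem of S1 and lift it by S2 or S3 according to whether
`ρ̄` is absolutely irreducible. [folklore] -/
theorem ProAutomorphy_of (h1 : _Goal.stub_residualOccurrence) (h2 : _Goal.stub_liftingAbsIrr)
    (h3 : _Goal.stub_liftingResRed) :
    Summit.Langlands.Langlands.Theses.CMFreeCompletedClosure.ProAutomorphy := by
  unfold _Goal.stub_residualOccurrence at h1
  unfold _Goal.stub_liftingAbsIrr at h2
  unfold _Goal.stub_liftingResRed at h3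
  intro E _ _ hE n hn R ℓ _ ρ hirr hgeo
  obtain ⟨𝒰, i, a, hocc, hres⟩ := h1 E hE n hn R ℓ ρ hirr hgeo
  by_cases habs : ρ.IsResiduallyAbsIrreducible
  · exact h2 E hE n hn R ℓ ρ hirr hgeo habs 𝒰 i a hocc hres
  · exact h3 E hE n hn R ℓ ρ hirr hgeo habs 𝒰 i a hocc hres

/-- The same composition with the three registered stubs consumed BY NAME (inherits their
`sorry`s, contains none). [folklore] -/
theorem ProAutomorphy_of_stubs :
    Summit.Langlands.Langlands.Theses.CMFreeCompletedClosure.ProAutomorphy :=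
  ProAutomorphy_of stub_residualOccurrence stub_liftingAbsIrr stub_liftingResRed

end Summit.Langlands.Langlands.Cruxes.ProAutomorphy.Birth

end
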